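import Summits.BirchSwinnertonDyer.BirchSwinnertonDyer.Theorems.CyclotomicUntwistUntwistedNonvanishing
import Summits.BirchSwinnertonDyer.BirchSwinnertonDyer.Theorems.CyclotomicUntwistNonvanishingTwistsAtLevel
import Literature.NumberTheory.EllipticCurves.PAdicLFunctionNonvanishingProofs
import HarnessLib

/-!
# The untwisted `p`-adic `L`-function of D1 is NOT identically zero — unconditionally

Cell `pub/bsd-wall` (D-0145 line `route-BirchSwinnertonDyer-CyclotomicUntwist`), seat `bsd-line-cycu-p5`
(width seat 5), helper toward crux K1 `PSRankOneLowerHalfAtThree` (stmt-BirchSwinnertonDyer-21580):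
step 3 of 3. THEOREMS ONLY (no definition, no named fact, no `sorry`); BSD is not proved by this file
and no crux is.

`CyclotomicUntwistUntwistedNonvanishing.exists_apply_ne_zero_of_rohrlich` (seat cycu-p1) proves: if
`μ` has the D1 property `IsUntwistedPAdicLFunction p f η α μ` for a rational newform `f`, `η`
primitive mod `p^c` (`c ≥ 1`), `α ≠ 0`, then some ball value `μ n s ≠ 0` — GIVEN the hypothesis `hR`
that only finitely many primitive characters of `p`-power conductor have `L(f, χ, 1) = 0` (for
`p ∣ N` the source would be Rohrlich, Invent. Math. 97 (1989), not in the tree). Here `hR` is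
REMOVED: the first-moment non-vanishing at a prime dividing the level
(`PSNonvanishingAtLevel.exists_wildChars_twistedSymbolSum_ne_zero_atkinLehner` /
`…_of_isNewformOf`, companion `CyclotomicUntwistNonvanishingTwistsAtLevel`, via the Atkin–Lehner
flip at the prime-to-`p` part of the level) supplies, for all large `m`, a wild character `χ` of
conductor `p^m` with `∑_a χ(a){∞, a/p^m}_f ≠ 0`, whereas `μ ≡ 0` kills
`∑_a ξ(a)[a/p^m]⁺_f` for EVERY wild `ξ` of conductor `p^m ≥ p^{2c}`
(`PSUntwistNonvanishing.ratTwistedSymbolSum_eq_zero_of_forall_eq_zero`, transported `ℂ ← ℚ̄ → ℂ_p`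
by `exists_ringHomComp_eq`), hence by Birch's formula (`ratTwistedSymbolSum_mul_plusPeriod_holds`,
`twisted_LValue_eq_holds`) every such `∑_a χ(a){∞, a/p^m}_f` — contradiction.

* `exists_apply_ne_zero_of_coeffBound` — for ANY prime `p`, any rational normalised newform
  `f ∈ S₂(Γ₀(N))` with `|aₙ| ≤ C n^θ` (`θ < 2/3`), `η` primitive mod `p^c` (`c ≥ 1`), `α ≠ 0`:
  `IsUntwistedPAdicLFunction p f η α μ ⇒ ∃ n s, μ n s ≠ 0`;
* `exists_apply_ne_zero` — the same for the newform of an elliptic curve `E/ℚ` (Hasse bound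
  `θ = 5/8`), at ANY prime `p` (good or bad);
* `exists_apply_ne_zero_of_isPSCyclotomicLFunctionOf` — the route's D1 predicate (`p = 3`, `η` mod
  `9`): **`IsPSCyclotomicLFunctionOf W η α μ`, `η` primitive, `α ≠ 0` ⇒ `𝓛^η_W` has a non-zero
  ball value**, with NO Rohrlich hypothesis — on every principal-series row of K1/K2 the D1 object
  is non-trivial (route kill criterion (iii) context; the closers' `∃ η α 𝓛, IsPSCyclotomicLFunctionOf
  W η α 𝓛 ∧ …` binders are never inhabited by `𝓛 = 0`).

References: B. Mazur, J. Tate, J. Teitelbaum, Invent. Math. 84 (1986), §I.8 (8.6), §I.14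
[cite: MazurTateTeitelbaum1986Invent, §I.14]; D. E. Rohrlich, Invent. Math. 75 (1984) (the method)
[cite: RohrlichInventiones1984, §3].
-/

noncomputable section

open scoped MatrixGroups

open CongruenceSubgroup DirichletCharacter Literature.NumberTheory.EllipticCurves
  Literature.NumberTheory.EllipticCurves.ModularForms Literature.NumberTheory.IwasawaTheory
  Summit.BirchSwinnertonDyer.BirchSwinnertonDyer.Theorems.PSNonvanishingAtLevel
  Summit.BirchSwinnertonDyer.BirchSwinnertonDyer.Theorems.PSUntwistNonvanishing

-- single-conjunct summit: `Summit.BirchSwinnertonDyer.BirchSwinnertonDyer.…` repeats the name by design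
set_option linter.dupNamespace false
set_option autoImplicit false

namespace Summit.BirchSwinnertonDyer.BirchSwinnertonDyer.Theorems.PSUntwistNonvanishingUnconditional

variable {p : ℕ} [Fact p.Prime]

section Unconditional

variable {N : ℕ} [NeZero N] {f : CuspForm (Gamma0 N) 2}
variable {c : ℕ} {η : DirichletCharacter ℂ_[p] (p ^ c)} {α : ℂ_[p]} {μ : (n : ℕ) → ZMod (p ^ n) → ℂ_[p]}

/-- **`μ ≡ 0` kills every COMPLEX wild twisted symbol sum of conductor `p^m ≥ p^{2c}`.** For `μ`
with the D1 property, `η` primitive mod `p^c` (`c ≥ 1`), `α ≠ 0`, `f` a rational normalised newform: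
if all ball values of `μ` vanish then `∑_{a mod p^m} χ(a){∞, a/p^m}_f = 0` for every `χ ∈ 𝔛_m`
(primitive, even, of `p`-power order, with values in `ℂ`), `m ≥ 2c`, `m ≥ 1`: write `χ = σψ` for a
`ℚ̄`-valued `ψ` (`exists_ringHomComp_eq`), apply `ratTwistedSymbolSum_eq_zero_of_forall_eq_zero` to
`τψ` over `ℂ_p` (the rational plus symbols transport along ring maps), and convert
`∑ χ(a)[a/p^m]⁺_f = 0` into the vanishing of the modular-symbol sum by Birch's formula
(`ratTwistedSymbolSum_mul_plusPeriod_holds`, `twisted_LValue_eq_holds`).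
[cite: MazurTateTeitelbaum1986Invent, §I.8 (8.6)] -/
theorem twistedSymbolSum_eq_zero_of_forall_eq_zero (hμ : IsUntwistedPAdicLFunction p f η α μ)
    (hc : 0 < c) (hη : η.IsPrimitive) (hα : α ≠ 0) (hf : IsNewform0 f) (hQ : coeffField f = ⊥)
    (h0 : ∀ (n : ℕ) (s : ZMod (p ^ n)), μ n s = 0) {m : ℕ} [NeZero (p ^ m)] (hm : 2 * c ≤ m)
    {χ : DirichletCharacter ℂ (p ^ m)} (hχ : χ ∈ wildChars p m) : twistedSymbolSum f χ = 0 := by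
  obtain ⟨hprimC, hevenC, hordC⟩ := (mem_wildChars χ).mp hχ
  -- transport `ℂ ← ℚ̄ → ℂ_p`
  let K := AlgebraicClosure ℚ
  let σ : K →+* ℂ := (@IsAlgClosed.lift ℂ _ _ ℚ _ _ K _ _ (AlgebraicClosure.instAlgebra ℚ) _ _ _
    (AlgebraicClosure.isAlgebraic ℚ)).toRingHom
  let τ : K →+* ℂ_[p] := (@IsAlgClosed.lift ℂ_[p] _ _ ℚ _ _ K _ _
    (AlgebraicClosure.instAlgebra ℚ) _ _ _ (AlgebraicClosure.isAlgebraic ℚ)).toRingHom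
  obtain ⟨ψ, hψ⟩ := exists_ringHomComp_eq σ χ
  have hψprim : ψ.IsPrimitive := (isPrimitive_ringHomComp_iff σ ψ).mp (hψ ▸ hprimC)
  have hψeven : ψ.Even := (even_ringHomComp_iff σ ψ).mp (hψ ▸ hevenC)
  have hψord : ∃ j : ℕ, orderOf ψ = p ^ j := by rwa [← orderOf_ringHomComp σ ψ, hψ]
  have hzero : ratTwistedSymbolSum f χ = 0 := by
    have hτ0 : ratTwistedSymbolSum f (ψ.ringHomComp τ) = 0 :=
      ratTwistedSymbolSum_eq_zero_of_forall_eq_zero hμ hc hη hα h0 hm _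
        ((isPrimitive_ringHomComp_iff τ ψ).mpr hψprim)
        ((even_ringHomComp_iff τ ψ).mpr hψeven) (by rw [orderOf_ringHomComp]; exact hψord)
    rw [ratTwistedSymbolSum_ringHomComp, map_eq_zero] at hτ0
    rw [← hψ, ratTwistedSymbolSum_ringHomComp, hτ0, map_zero]
  -- Birch: `(∑ χ(a)[a/m]⁺) Ω⁺ = τ(χ) L(f, χ⁻¹, 1)` and `τ(χ) L(f, χ⁻¹, 1) = ∑ χ(a){∞, a/m}`
  obtain ⟨L, hLd, hL⟩ := exists_differentiable_eq_twistedLSeries_holds f χ⁻¹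
  have hBirch := ratTwistedSymbolSum_mul_plusPeriod_holds (f := f) hf hQ hprimC hevenC hLd hL
  rw [hzero, zero_mul] at hBirch
  have hinvprim : DirichletCharacter.IsPrimitive χ⁻¹ := by
    rw [DirichletCharacter.isPrimitive_def, DirichletCharacter.conductor_inv]; exact hprimC
  have hLV := twisted_LValue_eq_holds f hinvprim hLd hL
  rw [inv_inv] at hLV
  rw [← hLV, ← hBirch]

/-- **The untwisted `p`-adic `L`-function is not identically zero — no Rohrlich hypothesis.** Let
`f ∈ S₂(Γ₀(N))` be a normalised newform with rational coefficients and `|aₙ| ≤ C n^θ` for some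
`θ < 2/3`, `p` ANY prime (dividing `N` or not), `η` a primitive Dirichlet character mod `p^c`
(`c ≥ 1`), `α ≠ 0`, and `μ` ball values with the D1 property `IsUntwistedPAdicLFunction p f η α μ`.
Then some ball value of `μ` is non-zero: otherwise `twistedSymbolSum_eq_zero_of_forall_eq_zero`
contradicts the first-moment non-vanishing `exists_wildChars_twistedSymbolSum_ne_zero_atkinLehner`
(Atkin–Lehner flip at the prime-to-`p` part `Q = N/p^{v_p(N)}`, newform `w_Q`-eigen by
`IsNewform0.exists_atkinLehnerInvolution_eq_smul`) at a large conductor `p^m`, `m ≥ 2c`. This is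
`exists_apply_ne_zero_of_rohrlich` with its hypothesis `hR` discharged.
[cite: MazurTateTeitelbaum1986Invent, §I.14 (case p ∣ N)] -/
theorem exists_apply_ne_zero_of_coeffBound (hμ : IsUntwistedPAdicLFunction p f η α μ) (hc : 0 < c)
    (hη : η.IsPrimitive) (hα : α ≠ 0) (hf : IsNewform0 f) (hQ : coeffField f = ⊥)
    {C θ : ℝ} (hC : 0 ≤ C) (hθ : 0 < θ) (hθ1 : θ < 2 / 3)
    (ha : ∀ n : ℕ, ‖cuspCoeff f n‖ ≤ C * (n : ℝ) ^ θ) :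
    ∃ (n : ℕ) (s : ZMod (p ^ n)), μ n s ≠ 0 := by
  by_contra h0
  push Not at h0
  have hp : p.Prime := Fact.out
  -- the Atkin–Lehner data at the prime-to-`p` part of the level
  obtain ⟨hQN, hcop, hpQ, hNm⟩ := ordCompl_exactDivisor (p := p) (NeZero.ne N)
  haveI : NeZero (ordCompl[p] N) := ⟨(Nat.ordCompl_pos p (NeZero.ne N)).ne'⟩
  obtain ⟨ε, hε1, hε⟩ := hf.exists_atkinLehnerInvolution_eq_smul hQN hcop
  have hε2 : ε ^ 2 = 1 := by
    rcases hε1 with rfl | rfl <;> norm_num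
  have h1 : cuspCoeff f 1 = 1 := (isNormalized_iff_cuspCoeff_one f).mp hf.2.2
  obtain ⟨m₀, hm₀⟩ := exists_wildChars_twistedSymbolSum_ne_zero_atkinLehner f hQN hcop hε hε2 hpQ
    hNm hC hθ hθ1 ha h1
  obtain ⟨χ, hχ, hne⟩ := hm₀ (max m₀ (2 * c)) (le_max_left _ _)
  haveI : NeZero (p ^ max m₀ (2 * c)) := ⟨pow_ne_zero _ hp.ne_zero⟩
  exact hne (twistedSymbolSum_eq_zero_of_forall_eq_zero hμ hc hη hα hf hQ h0 (le_max_right _ _) hχ)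

/-- **`𝓛 ≢ 0` for the newform of an elliptic curve, at any prime.** For `E = W/ℚ` elliptic with
newform `f` (`IsNewformOf W f`), ANY prime `p`, `η` primitive mod `p^c` (`c ≥ 1`), `α ≠ 0`:
`IsUntwistedPAdicLFunction p f η α μ ⇒ ∃ n s, μ n s ≠ 0` (`exists_apply_ne_zero_of_coeffBound`
with the Ramanujan–Hasse bound `|aₙ(E)| ≤ 16²⁵⁶ n^{5/8}`, `WeierstrassCurve.norm_LFunction_le_rpow`).
[cite: MazurTateTeitelbaum1986Invent, §I.14 (case p ∣ N)] -/
theorem exists_apply_ne_zero {W : WeierstrassCurve ℚ} [W.IsElliptic]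
    (hμ : IsUntwistedPAdicLFunction p f η α μ) (hc : 0 < c) (hη : η.IsPrimitive) (hα : α ≠ 0)
    (hf : IsNewformOf W f) : ∃ (n : ℕ) (s : ZMod (p ^ n)), μ n s ≠ 0 :=
  exists_apply_ne_zero_of_coeffBound hμ hc hη hα hf.1 hf.coeffField_eq_bot (C := (16 : ℝ) ^ 256)
    (θ := 5 / 8) (by positivity) (by norm_num) (by norm_num)
    (fun n ↦ by rw [hf.2 n]; exact W.norm_LFunction_le_rpow n)

end Unconditional

/-- **The route's D1 object is never identically zero** (`p = 3`, `η` mod `9`): for an elliptic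
curve `W/ℚ`, if `IsPSCyclotomicLFunctionOf W η α μ` with `η` primitive mod `9` and `α ≠ 0`, then
`𝓛^η_W = μ` has a non-zero ball value — UNCONDITIONALLY (the Rohrlich-1989 hypothesis `hR` of
`exists_apply_ne_zero_of_isPSCyclotomicLFunctionOf` is discharged by the first-moment theorem at
`3 ∣ N`). In particular on every principal-series row of K1/K2 (`3⁴ ∥ N`) the twisted
Mazur–Tate–Teitelbaum/Kato `3`-adic `L`-function of the untwist named by D1 is non-trivial.
[cite: MazurTateTeitelbaum1986Invent, §I.14 (case p ∣ N)] -/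
theorem exists_apply_ne_zero_of_isPSCyclotomicLFunctionOf' {W : WeierstrassCurve ℚ} [W.IsElliptic]
    {η : DirichletCharacter ℂ_[3] (3 ^ 2)} {α : ℂ_[3]} {μ : (n : ℕ) → ZMod (3 ^ n) → ℂ_[3]}
    (hμ : IsPSCyclotomicLFunctionOf W η α μ) (hη : η.IsPrimitive) (hα : α ≠ 0) :
    ∃ (n : ℕ) (s : ZMod (3 ^ n)), μ n s ≠ 0 := by
  obtain ⟨N, hN, f, hf, hμf⟩ := hμ
  exact exists_apply_ne_zero hμf (by norm_num) hη hα hf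

end Summit.BirchSwinnertonDyer.BirchSwinnertonDyer.Theorems.PSUntwistNonvanishingUnconditional
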